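import Literature.NumberTheory.PAdicHodge.TateInvariantsBase
import Literature.NumberTheory.PAdicHodge.KummerTraceOneElement
import HarnessLib

/-!
# `p`-th powers in the cyclotomic tower `K_∞ = K₀(μ_{p^∞})`: the almost-perfectoid package
# (toward Tate's almost étale lemma, Tate 1967 §3.2 Prop. 9 / Berger–Colmez (TS1))

For a non-archimedean local field `F` of characteristic `0` and residue characteristic `p`,
`K₀ = PadicBase F p hp ≅ ℚ_p`, `F̄ = NormedAlgClosure F`, and the tree's cyclotomic tower
`K m = K₀(ζ_{p^m})` (`CyclotomicTower.K`), `K_∞ = ⋃ K m` (`TateTrace.Kinf`), this file proves the two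
arithmetic facts about `K_∞` on which the elementary ("Kummer-depth") proof of Tate's almost étale
lemma rests — the almost-perfectoid package of `K_∞`:

* `TateAlmostEtale.Kinf_exists_norm_pow_eq` : **the value group of `K_∞` is `p`-divisible** — every
  `x ∈ K_∞^×` has some `c ∈ K_∞` with `‖c‖ ^ p = ‖x‖` (indeed `‖K m^×‖ = ‖ζ_{p^m} - 1‖^ℤ` and
  `‖μ - 1‖^p = ‖ζ_{p^m} - 1‖` for a primitive `p^{m+1}`-th root `μ`);
* `TateAlmostEtale.Kinf_exists_norm_sub_pow_le` : **every integer of `K_∞` is a `p`-th power modulo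
  `p`** — for `u ∈ K_∞`, `‖u‖ ≤ 1`, there is `w ∈ K_∞` with `‖u - w ^ p‖ ≤ ‖p‖` (Frobenius is surjective on
  `𝓞_{K_∞}/p`: write `u = Σ s_j π_m^j` with `s_j ∈ ℤ_p` in the orthogonal `π_m`-basis of the tree
  (`CyclotomicTower.norm_coeff_mul_le_norm_aeval`), take `w = Σ s_j π'^j` with `π' = μ - 1`, `μ^p = ζ_{p^m}`,
  and use `s_j^p ≡ s_j`, `π'^p ≡ π_m (mod p)`).

together with the generic ultrametric estimates they need (`norm_add_pow_sub_le`,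
`norm_sum_pow_sub_sum_pow_le` : `‖(Σ a_j)^p - Σ a_j^p‖ ≤ ‖p‖` for integral `a_j`;
`norm_pow_sub_pow_le` : `‖x^j - y^j‖ ≤ ‖x - y‖`), the Fermat congruence in `K₀`
(`PadicBase.norm_pow_sub_self_le`), the integrality of the `π_m`-coordinates of an integer of `K m`
(`norm_coeff_le_one_of_norm_aeval_le_one`) and the `p`-th root `μ ∈ K (m+1)` of `ζ_{p^m}`
(`exists_isPrimitiveRoot_pow_eq_zeta`). These are the hypotheses of the Kummer-depth iteration
(`KummerDepth.lean`), whose output feeds the explicit trace-one element of `KummerTraceOneElement`.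
Own elementary route to the statement of Tate 1967 §3.2 Prop. 9 (Berger–Colmez 2008 Prop. 4.1.1);
no differents, no ramification filtration. No `sorry`, no definitions.

References: J. Tate, *p-divisible groups* (1967), §3.1 (the tower `K_n`), §3.2 Prop. 9 [Tate1967];
L. Berger, P. Colmez, Astérisque 319 (2008), Prop. 4.1.1 [BergerColmez2008]; J.-P. Serre, *Local
Fields*, Ch. IV §4 (`ℚ_p(ζ_{p^m})`: uniformiser `ζ - 1`, integers `ℤ_p[ζ]`) [SerreLocalFields1979].
-/

noncomputable section

open ValuativeRel Field Polynomial Finset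

open scoped IntermediateField

namespace Literature.NumberTheory.PAdicHodge

open Literature.NumberTheory.GaloisRepresentations
open Literature.NumberTheory.GaloisRepresentations.IsNonarchimedeanLocalField
open CyclotomicTower TateTrace

namespace TateAlmostEtale

/-! ### Generic ultrametric estimates -/

section Ultrametric

variable {E : Type*} [NormedField E] [IsUltrametricDist E]

/-- For `p` prime and `‖a‖, ‖b‖ ≤ 1`: `‖(a + b)^p - a^p - b^p‖ ≤ ‖p‖` (the middle binomial coefficients
are divisible by `p`). [cite: SerreLocalFields1979, Ch. IV §4] [cite: Tate1967, §3.1] -/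
theorem norm_add_pow_sub_le {p : ℕ} (hp : p.Prime) (a b : E) (ha : ‖a‖ ≤ 1) (hb : ‖b‖ ≤ 1) :
    ‖(a + b) ^ p - a ^ p - b ^ p‖ ≤ ‖(p : E)‖ := by
  have hexp : (a + b) ^ p - a ^ p - b ^ p =
      ∑ k ∈ Finset.range (p - 1), (p.choose (k + 1) : E) * (a ^ (k + 1) * b ^ (p - (k + 1))) := by
    obtain ⟨n, rfl⟩ : ∃ n, p = n + 2 := ⟨p - 2, (Nat.sub_add_cancel hp.two_le).symm⟩
    have h1 : n + 2 - 1 = n + 1 := rfl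
    rw [h1, add_pow, Finset.sum_range_succ, Finset.sum_range_succ']
    simp only [pow_zero, Nat.sub_zero, one_mul, Nat.choose_zero_right, Nat.cast_one, mul_one,
      Nat.sub_self, Nat.choose_self]
    rw [Finset.sum_congr rfl (fun k _ =>
      (mul_comm (a ^ (k + 1) * b ^ (n + 2 - (k + 1))) ((n + 2).choose (k + 1) : E)))]
    ring
  rw [hexp]
  refine IsUltrametricDist.norm_sum_le_of_forall_le_of_nonneg (norm_nonneg _) fun k hk => ?_
  rw [Finset.mem_range] at hk
  obtain ⟨m, hm⟩ := hp.dvd_choose_self (Nat.succ_ne_zero k) (by omega)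
  rw [hm, Nat.cast_mul, norm_mul, norm_mul, norm_mul, norm_pow, norm_pow]
  have hmle : ‖(m : E)‖ ≤ 1 := IsUltrametricDist.norm_natCast_le_one E m
  calc ‖(p : E)‖ * ‖(m : E)‖ * (‖a‖ ^ (k + 1) * ‖b‖ ^ (p - (k + 1)))
      ≤ ‖(p : E)‖ * 1 * (1 * 1) := by
        gcongr
        · exact pow_le_one₀ (norm_nonneg _) ha
        · exact pow_le_one₀ (norm_nonneg _) hb
    _ = ‖(p : E)‖ := by ring

/-- For `p` prime and a finite family of `a_j` with `‖a_j‖ ≤ 1`: **`‖(Σ a_j)^p - Σ a_j^p‖ ≤ ‖p‖`**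
(Frobenius is additive modulo `p`). [cite: SerreLocalFields1979, Ch. IV §4] [cite: Tate1967, §3.1] -/
theorem norm_sum_pow_sub_sum_pow_le {p : ℕ} (hp : p.Prime) {ι : Type*} (s : Finset ι) (f : ι → E)
    (hf : ∀ i ∈ s, ‖f i‖ ≤ 1) :
    ‖(∑ i ∈ s, f i) ^ p - ∑ i ∈ s, f i ^ p‖ ≤ ‖(p : E)‖ := by
  classical
  induction s using Finset.induction_on with
  | empty => simp [hp.ne_zero]
  | @insert i s hi ih =>
    have hfi : ‖f i‖ ≤ 1 := hf i (Finset.mem_insert_self i s)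
    have hfs : ∀ j ∈ s, ‖f j‖ ≤ 1 := fun j hj => hf j (Finset.mem_insert_of_mem hj)
    have hS : ‖∑ j ∈ s, f j‖ ≤ 1 :=
      IsUltrametricDist.norm_sum_le_of_forall_le_of_nonneg zero_le_one hfs
    rw [Finset.sum_insert hi, Finset.sum_insert hi]
    have : (f i + ∑ j ∈ s, f j) ^ p - (f i ^ p + ∑ j ∈ s, f j ^ p) =
        ((f i + ∑ j ∈ s, f j) ^ p - f i ^ p - (∑ j ∈ s, f j) ^ p) +
          ((∑ j ∈ s, f j) ^ p - ∑ j ∈ s, f j ^ p) := by ring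
    rw [this]
    refine (IsUltrametricDist.norm_add_le_max _ _).trans (max_le ?_ (ih hfs))
    exact norm_add_pow_sub_le hp _ _ hfi hS

/-- For `‖x‖, ‖y‖ ≤ 1`: `‖x^j - y^j‖ ≤ ‖x - y‖` (`x - y ∣ x^j - y^j` with an integral cofactor).
[cite: SerreLocalFields1979, Ch. IV §4] -/
theorem norm_pow_sub_pow_le (x y : E) (hx : ‖x‖ ≤ 1) (hy : ‖y‖ ≤ 1) (j : ℕ) :
    ‖x ^ j - y ^ j‖ ≤ ‖x - y‖ := by
  have h := (Commute.all x y).geom_sum₂_mul j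
  rw [← h, norm_mul]
  refine mul_le_of_le_one_left (norm_nonneg _) ?_
  refine IsUltrametricDist.norm_sum_le_of_forall_le_of_nonneg zero_le_one fun i _ => ?_
  rw [norm_mul, norm_pow, norm_pow]
  exact mul_le_one₀ (pow_le_one₀ (norm_nonneg _) hx) (pow_nonneg (norm_nonneg _) _)
    (pow_le_one₀ (norm_nonneg _) hy)

/-- For `‖x‖ < 1`: `‖1 + x‖ = 1`. [folklore] -/
private theorem norm_one_add_eq_one {x : E} (hx : ‖x‖ < 1) : ‖1 + x‖ = 1 := by
  have h := IsUltrametricDist.norm_add_eq_max_of_norm_ne_norm (x := (1 : E)) (y := x)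
    (by rw [norm_one]; exact hx.ne')
  rw [h, norm_one, max_eq_left hx.le]

end Ultrametric

/-! ### The Fermat congruence in `K₀ ≅ ℚ_p` -/

variable {F : Type} [Field F] [ValuativeRel F] [TopologicalSpace F] [IsNonarchimedeanLocalField F]
  [CharZero F] {p : ℕ} [Fact p.Prime] (hp : valuation F p < 1)

/-- **Fermat in `ℤ_p`**: for `x ∈ K₀` with `‖x‖ ≤ 1` (i.e. `x ∈ ℤ_p`), `‖x^p - x‖ ≤ ‖p‖`
(`x^p ≡ x (mod p)` as `ℤ_p/p = 𝔽_p`). [cite: SerreLocalFields1979, Ch. II §5] -/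
theorem PadicBase.norm_pow_sub_self_le (x : PadicBase F p hp) (hx : ‖x‖ ≤ 1) :
    ‖x ^ p - x‖ ≤ ‖(p : PadicBase F p hp)‖ := by
  have hx' : ‖PadicBase.toPadic hp x‖ ≤ 1 := (PadicBase.norm_le_one_iff hp x).mp hx
  set z : ℤ_[p] := ⟨PadicBase.toPadic hp x, hx'⟩ with hz
  have hxz : x = PadicBase.ofPadicInt hp z := by
    rw [PadicBase.ofPadicInt_apply]
    change x = (PadicBase.toPadic hp).symm (PadicBase.toPadic hp x)
    rw [RingEquiv.symm_apply_apply]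
  -- `z^p - z ∈ p ℤ_p`
  have hmem : z ^ p - z ∈ Ideal.span {(p : ℤ_[p])} := by
    rw [← PadicInt.maximalIdeal_eq_span_p, ← PadicInt.ker_toZMod, RingHom.mem_ker, map_sub,
      map_pow, ZMod.pow_card, sub_self]
  obtain ⟨y, hy⟩ := Ideal.mem_span_singleton'.mp hmem
  rw [hxz, ← map_pow, ← map_sub, ← hy, map_mul, map_natCast, norm_mul]
  exact mul_le_of_le_one_left (norm_nonneg _) (PadicBase.norm_ofPadicInt_le_one hp y)

/-- The Fermat congruence read in `F̄`: for `x ∈ K₀`, `‖x‖ ≤ 1`: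
`‖algebraMap K₀ F̄ (x^p) - algebraMap K₀ F̄ x‖ ≤ ‖p‖`. [cite: SerreLocalFields1979, Ch. II §5] -/
theorem norm_algebraMap_pow_sub_le (x : PadicBase F p hp) (hx : ‖x‖ ≤ 1) :
    ‖algebraMap (PadicBase F p hp) (NormedAlgClosure F) x ^ p -
      algebraMap (PadicBase F p hp) (NormedAlgClosure F) x‖ ≤ ‖(p : NormedAlgClosure F)‖ := by
  rw [← map_pow, ← map_sub, PadicBase.norm_algebraMap_closure, PadicBase.norm_natCast_closure hp]
  exact PadicBase.norm_pow_sub_self_le hp x hx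

/-! ### Integrality of the `π_m`-coordinates of an integer of `K m` -/

/-- **Integers of `K m` have `ℤ_p`-coordinates in the `π_m`-basis**: if `s ∈ K₀[X]`,
`deg s < φ(p^m)`, and `‖s(π_m)‖ ≤ 1` (`π_m = ζ_{p^m} - 1`, `m ≥ 1`), then `‖s_j‖ ≤ 1` for every `j`
(orthogonality `‖s_j‖ ‖π_m‖^j ≤ ‖s(π_m)‖` and `‖π_m‖^j > ‖π_m‖^{φ(p^m)} = ‖p‖`, while `‖K₀^×‖ = ‖p‖^ℤ`):
`𝓞_{K m} = ℤ_p[ζ_{p^m}]`. [cite: SerreLocalFields1979, Ch. IV §4 Prop. 17] -/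
theorem norm_coeff_le_one_of_norm_aeval_le_one {m : ℕ} (hm : 1 ≤ m) (s : (PadicBase F p hp)[X])
    (hs : s.natDegree < (p ^ m).totient) (h1 : ‖aeval (zeta F p m - 1) s‖ ≤ 1) (j : ℕ) :
    ‖s.coeff j‖ ≤ 1 := by
  by_cases hj0 : s.coeff j = 0
  · rw [hj0, norm_zero]; exact zero_le_one
  have hjd : j ≤ s.natDegree := le_natDegree_of_ne_zero hj0
  have hjφ : j < (p ^ m).totient := lt_of_le_of_lt hjd hs
  have hπ1 := norm_zeta_sub_one_le_one (F := F) (p := p) m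
  have hπpos := norm_zeta_sub_one_pos (F := F) (p := p) hm
  have hkey := (norm_coeff_mul_le_norm_aeval hp hm s hs j).trans h1
  -- `‖s_j‖ = ‖p‖^v`, `v ∈ ℤ`; if `v ≤ -1` then `‖s_j‖ ‖π‖^j ≥ ‖p‖⁻¹ ‖π‖^{φ - 1} > 1`
  set t : ℝ := ‖(p : PadicBase F p hp)‖ with ht
  have ht0 : 0 < t := PadicBase.norm_p_pos hp
  have ht1 : t < 1 := PadicBase.norm_p_lt_one hp
  have hv := PadicBase.norm_eq_norm_p_zpow hp (s.coeff j) hj0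
  set v : ℤ := (PadicBase.toPadic hp (s.coeff j)).valuation with hvdef
  rcases le_or_gt ‖s.coeff j‖ 1 with hle | hgt
  · exact hle
  exfalso
  have hgt' : 1 < t ^ v := by rwa [hv] at hgt
  have hv0 : v < 0 := (one_lt_zpow_iff_right_of_lt_one₀ ht0 ht1).mp hgt'
  have hsj : t⁻¹ ≤ ‖s.coeff j‖ := by
    rw [hv, ← zpow_neg_one]
    exact zpow_le_zpow_right_of_le_one₀ ht0 ht1.le (by omega)
  have hπφ : ‖zeta F p m - 1‖ ^ (p ^ m).totient = t := by
    rw [ht, norm_zeta_sub_one_pow hm, PadicBase.norm_natCast_closure]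
  have hφpos : 0 < (p ^ m).totient := Nat.totient_pos.mpr (pow_pos' m)
  have hπlt1 : ‖zeta F p m - 1‖ < 1 := by
    rcases lt_or_ge ‖zeta F p m - 1‖ 1 with hlt | hge
    · exact hlt
    have : 1 ≤ ‖zeta F p m - 1‖ ^ (p ^ m).totient := one_le_pow₀ hge
    rw [hπφ] at this
    exact absurd this (not_le.mpr ht1)
  have hπj : t < ‖zeta F p m - 1‖ ^ j := by
    calc t = ‖zeta F p m - 1‖ ^ (p ^ m).totient := hπφ.symm
      _ < ‖zeta F p m - 1‖ ^ ((p ^ m).totient - 1) :=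
          pow_lt_pow_right_of_lt_one₀ hπpos hπlt1 (by omega)
      _ ≤ ‖zeta F p m - 1‖ ^ j := pow_le_pow_of_le_one hπpos.le hπ1 (by omega)
  have : (1 : ℝ) < ‖s.coeff j‖ * ‖zeta F p m - 1‖ ^ j := by
    calc (1 : ℝ) = t⁻¹ * t := by rw [inv_mul_cancel₀ ht0.ne']
      _ < t⁻¹ * ‖zeta F p m - 1‖ ^ j := by gcongr
      _ ≤ ‖s.coeff j‖ * ‖zeta F p m - 1‖ ^ j := by gcongr
  linarith

/-! ### A primitive `p^{m+1}`-th root of unity `μ ∈ K (m+1)` with `μ^p = ζ_{p^m}` -/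

/-- For `m ≥ 1` there is a primitive `p^{m+1}`-th root of unity `μ` with `μ ^ p = ζ_{p^m}` (so
`μ ∈ K (m+1)`): `ζ_{p^m} = ζ_{p^{m+1}}^{p k}` with `p ∤ k`, `μ = ζ_{p^{m+1}}^k`. [cite: Tate1967, §3.1] -/
theorem exists_isPrimitiveRoot_pow_eq_zeta {m : ℕ} (hm : 1 ≤ m) :
    ∃ μ : NormedAlgClosure F, μ ∈ K hp (m + 1) ∧ IsPrimitiveRoot μ (p ^ (m + 1)) ∧
      μ ^ p = zeta F p m := by
  have hprime : p.Prime := Fact.out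
  obtain ⟨i, hi⟩ := exists_zeta_eq_pow (F := F) (p := p) (Nat.le_succ m)
  have hζ := zeta_spec F p (m + 1)
  have hζm := zeta_spec F p m
  -- `p ∣ i`: `ζ_{m+1}^{i p^m} = ζ_m^{p^m} = 1`, so `p^{m+1} ∣ i p^m`
  have hdvd : p ∣ i := by
    have h1 : zeta F p (m + 1) ^ (i * p ^ m) = 1 := by rw [pow_mul, ← hi, hζm.pow_eq_one]
    have h2 := hζ.dvd_of_pow_eq_one _ h1
    rw [pow_succ, mul_comm i] at h2
    exact Nat.dvd_of_mul_dvd_mul_left (pow_pos hprime.pos m) h2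
  obtain ⟨k, rfl⟩ := hdvd
  -- `p ∤ k`: otherwise `ζ_m^{p^{m-1}} = 1`
  have hk : ¬ p ∣ k := by
    rintro ⟨k', rfl⟩
    obtain ⟨m', rfl⟩ : ∃ m', m = m' + 1 := ⟨m - 1, (Nat.sub_add_cancel hm).symm⟩
    have h1 : zeta F p (m' + 1) ^ p ^ m' = 1 := by
      rw [hi, ← pow_mul]
      have : p * (p * k') * p ^ m' = p ^ (m' + 1 + 1) * k' := by ring
      rw [this, pow_mul, hζ.pow_eq_one, one_pow]
    have h2 := hζm.dvd_of_pow_eq_one _ h1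
    have h3 : p ^ (m' + 1) ≤ p ^ m' := Nat.le_of_dvd (pow_pos hprime.pos m') h2
    have h4 : p ^ m' < p ^ (m' + 1) := Nat.pow_lt_pow_right hprime.one_lt (Nat.lt_succ_self m')
    omega
  refine ⟨zeta F p (m + 1) ^ k, pow_mem (zeta_mem_K hp (m + 1)) k, ?_, ?_⟩
  · rw [hζ.pow_iff_coprime (pow_pos hprime.pos _)]
    exact Nat.Coprime.pow_right _ (hprime.coprime_iff_not_dvd.mpr hk).symm
  · rw [← pow_mul, mul_comm, ← hi]

/-- The norm of `μ - 1` for a primitive `p^{m+1}`-th root `μ` (`m ≥ 1`): **`‖μ - 1‖ ^ p = ‖ζ_{p^m} - 1‖`**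
(`‖μ - 1‖^{φ(p^{m+1})} = ‖p‖ = ‖ζ_{p^m} - 1‖^{φ(p^m)}` and `φ(p^{m+1}) = p φ(p^m)`).
[cite: SerreLocalFields1979, Ch. IV §4] [cite: Tate1967, §3.1] -/
theorem norm_sub_one_pow_prime_eq {m : ℕ} (hm : 1 ≤ m) {μ : NormedAlgClosure F}
    (hμ : IsPrimitiveRoot μ (p ^ (m + 1))) : ‖μ - 1‖ ^ p = ‖zeta F p m - 1‖ := by
  have hprime : p.Prime := Fact.out
  obtain ⟨m', rfl⟩ : ∃ m', m = m' + 1 := ⟨m - 1, (Nat.sub_add_cancel hm).symm⟩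
  have h1 : ‖μ - 1‖ ^ (p ^ (m' + 1 + 1)).totient = ‖(p : NormedAlgClosure F)‖ := by
    rw [norm_sub_one_eq_of_isPrimitiveRoot hμ, norm_zeta_sub_one_pow (by omega)]
  have h2 : ‖zeta F p (m' + 1) - 1‖ ^ (p ^ (m' + 1)).totient = ‖(p : NormedAlgClosure F)‖ :=
    norm_zeta_sub_one_pow (by omega)
  rw [Nat.totient_prime_pow_succ hprime] at h1 h2
  have htot : p ^ (m' + 1) * (p - 1) = p * (p ^ m' * (p - 1)) := by ring
  rw [htot, pow_mul] at h1
  have hne : p ^ m' * (p - 1) ≠ 0 :=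
    Nat.mul_ne_zero (pow_pos hprime.pos _).ne' (Nat.sub_ne_zero_of_lt hprime.one_lt)
  exact (pow_left_inj₀ (pow_nonneg (norm_nonneg _) _) (norm_nonneg _) hne).mp (h1.trans h2.symm)

/-! ### Every integer of `K_∞` is a `p`-th power modulo `p` -/

/-- **Frobenius is surjective on `𝓞_{K m} → 𝓞_{K (m+1)}/p`**: for `u ∈ K m` (`m ≥ 1`) with `‖u‖ ≤ 1`
there is `w ∈ K (m+1)` with `‖u - w ^ p‖ ≤ ‖p‖`. With `u = Σ s_j π_m^j` (`s_j ∈ ℤ_p`), take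
`w = Σ s_j π'^j`, `π' = μ - 1`, `μ^p = ζ_{p^m}`: then `w^p ≡ Σ s_j^p π'^{pj} ≡ Σ s_j π_m^j (mod p)`.
[cite: Tate1967, §3.2 Prop. 9] [cite: BergerColmez2008, Prop. 4.1.1] -/
theorem exists_norm_sub_pow_le_of_mem_K {m : ℕ} (hm : 1 ≤ m) {u : NormedAlgClosure F}
    (hu : u ∈ K hp m) (h1 : ‖u‖ ≤ 1) :
    ∃ w : NormedAlgClosure F, w ∈ K hp (m + 1) ∧ ‖u - w ^ p‖ ≤ ‖(p : NormedAlgClosure F)‖ := by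
  have hprime : p.Prime := Fact.out
  set K₀ := PadicBase F p hp
  obtain ⟨s, hs, hsu⟩ := exists_aeval_pi_eq hp hu
  obtain ⟨μ, hμK, hμprim, hμp⟩ := exists_isPrimitiveRoot_pow_eq_zeta hp hm
  set π : NormedAlgClosure F := zeta F p m - 1 with hπdef
  set π' : NormedAlgClosure F := μ - 1 with hπ'def
  have hint : ∀ j, ‖s.coeff j‖ ≤ 1 := fun j =>
    norm_coeff_le_one_of_norm_aeval_le_one hp hm s hs (hsu.symm ▸ h1) j
  have hπ1 : ‖π‖ ≤ 1 := norm_zeta_sub_one_le_one (F := F) (p := p) m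
  have hμ1 : ‖μ‖ = 1 := norm_eq_one_of_pow_eq_one hμprim.pow_eq_one
  have hπ'1 : ‖π'‖ ≤ 1 := by
    rw [hπ'def, sub_eq_add_neg]
    refine (IsUltrametricDist.norm_add_le_max _ _).trans ?_
    rw [norm_neg, hμ1, norm_one, max_self]
  -- `π = (1 + π')^p - 1`, so `‖π'^p - π‖ ≤ ‖p‖`
  have hππ' : ‖π' ^ p - π‖ ≤ ‖(p : NormedAlgClosure F)‖ := by
    have : π' ^ p - π = -((1 + π') ^ p - 1 - π' ^ p) := by
      rw [hπdef, ← hμp, hπ'def]; ring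
    rw [this, norm_neg]
    exact (KummerTrace.norm_one_add_pow_sub_le hprime π' hπ'1).trans
      (mul_le_of_le_one_right (norm_nonneg _) hπ'1)
  -- the candidate `w = s(π')`
  set π'K : K hp (m + 1) := ⟨π', sub_mem hμK (one_mem _)⟩ with hπ'K
  refine ⟨aeval π' s, ?_, ?_⟩
  · have : aeval π' s = ((aeval π'K s : K hp (m + 1)) : NormedAlgClosure F) :=
      IntermediateField.aeval_coe (K hp (m + 1)) π'K s
    rw [this]; exact SetLike.coe_mem _
  -- write both as sums over `range (d+1)`
  set d := s.natDegree with hd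
  set c : ℕ → NormedAlgClosure F := fun j => algebraMap K₀ (NormedAlgClosure F) (s.coeff j) with hc
  have hc1 : ∀ j, ‖c j‖ ≤ 1 := fun j => by
    rw [hc]; dsimp only; rw [PadicBase.norm_algebraMap_closure]; exact hint j
  have hu_sum : u = ∑ j ∈ Finset.range (d + 1), c j * π ^ j := by
    rw [← hsu, aeval_eq_sum_range]
    exact Finset.sum_congr rfl fun j _ => Algebra.smul_def _ _
  have hw_sum : aeval π' s = ∑ j ∈ Finset.range (d + 1), c j * π' ^ j := by
    rw [aeval_eq_sum_range]
    exact Finset.sum_congr rfl fun j _ => Algebra.smul_def _ _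
  have hdecomp : u - (aeval π' s) ^ p =
      -(((∑ j ∈ Finset.range (d + 1), c j * π' ^ j) ^ p
          - ∑ j ∈ Finset.range (d + 1), (c j * π' ^ j) ^ p)
        + (∑ j ∈ Finset.range (d + 1), (c j * π' ^ j) ^ p
          - ∑ j ∈ Finset.range (d + 1), c j * π ^ j)) := by
    rw [hu_sum, hw_sum]; ring
  rw [hdecomp, norm_neg]
  refine (IsUltrametricDist.norm_add_le_max _ _).trans (max_le ?_ ?_)
  · -- Frobenius is additive mod `p`
    refine norm_sum_pow_sub_sum_pow_le hprime _ _ fun j _ => ?_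
    rw [norm_mul, norm_pow]
    exact mul_le_one₀ (hc1 j) (pow_nonneg (norm_nonneg _) _) (pow_le_one₀ (norm_nonneg _) hπ'1)
  · have hsd : ∑ j ∈ Finset.range (d + 1), ((c j * π' ^ j) ^ p - c j * π ^ j)
        = (∑ j ∈ Finset.range (d + 1), (c j * π' ^ j) ^ p)
          - ∑ j ∈ Finset.range (d + 1), c j * π ^ j :=
      Finset.sum_sub_distrib _ _
    refine le_of_eq_of_le (congrArg _ hsd.symm) ?_
    refine IsUltrametricDist.norm_sum_le_of_forall_le_of_nonneg (norm_nonneg _) fun j _ => ?_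
    -- `(c_j π'^j)^p - c_j π^j = (c_j^p - c_j) π'^{jp} + c_j ((π'^p)^j - π^j)`
    have : (c j * π' ^ j) ^ p - c j * π ^ j =
        (c j ^ p - c j) * (π' ^ j) ^ p + c j * ((π' ^ p) ^ j - π ^ j) := by ring
    rw [this]
    refine (IsUltrametricDist.norm_add_le_max _ _).trans (max_le ?_ ?_)
    · rw [norm_mul, norm_pow, norm_pow]
      refine (mul_le_of_le_one_right (norm_nonneg _)
        (pow_le_one₀ (pow_nonneg (norm_nonneg _) _) (pow_le_one₀ (norm_nonneg _) hπ'1))).trans ?_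
      exact norm_algebraMap_pow_sub_le hp (s.coeff j) (hint j)
    · rw [norm_mul]
      refine (mul_le_of_le_one_left (norm_nonneg _) (hc1 j)).trans ?_
      have hπ'p : ‖π' ^ p‖ ≤ 1 := by rw [norm_pow]; exact pow_le_one₀ (norm_nonneg _) hπ'1
      exact (norm_pow_sub_pow_le _ _ hπ'p hπ1 j).trans hππ'

/-- **Every integer of `K_∞` is a `p`-th power modulo `p`** (Frobenius is surjective on `𝓞_{K_∞}/p`):
for `u ∈ K_∞` with `‖u‖ ≤ 1` there is `w ∈ K_∞` with `‖u - w ^ p‖ ≤ ‖p‖`. Second half of the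
almost-perfectoid package of `K_∞` used by the Kummer-depth proof of Tate's almost étale lemma.
[cite: Tate1967, §3.2 Prop. 9] [cite: BergerColmez2008, Prop. 4.1.1] -/
theorem Kinf_exists_norm_sub_pow_le {u : NormedAlgClosure F} (hu : u ∈ Kinf hp) (h1 : ‖u‖ ≤ 1) :
    ∃ w : NormedAlgClosure F, w ∈ Kinf hp ∧ ‖u - w ^ p‖ ≤ ‖(p : NormedAlgClosure F)‖ := by
  obtain ⟨M, hM, huM⟩ := exists_mem_K_of_mem_Kinf hp hu 0
  obtain ⟨w, hw, hle⟩ := exists_norm_sub_pow_le_of_mem_K hp hM huM h1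
  exact ⟨w, K_le_Kinf hp _ hw, hle⟩

/-! ### The value group of `K_∞` is `p`-divisible -/

/-- **`‖K m^×‖ = ‖π_m‖^ℤ`** (`π_m = ζ_{p^m} - 1`, `m ≥ 1`): every non-zero `x ∈ K m` has
`‖x‖ = ‖π_m‖^N` for some `N ∈ ℤ` (in the orthogonal `π_m`-basis the norm of `x = Σ s_j π_m^j` is the
largest `‖s_j‖ ‖π_m‖^j = ‖π_m‖^{v φ(p^m) + j}`). `K m / ℚ_p` is totally ramified with uniformiser `π_m`.
[cite: SerreLocalFields1979, Ch. IV §4 Prop. 17] [cite: Tate1967, §3.1] -/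
theorem exists_norm_eq_zpow_of_mem_K {m : ℕ} (hm : 1 ≤ m) {x : NormedAlgClosure F}
    (hx : x ∈ K hp m) (hx0 : x ≠ 0) : ∃ N : ℤ, ‖x‖ = ‖zeta F p m - 1‖ ^ N := by
  set K₀ := PadicBase F p hp
  obtain ⟨s, hs, hsx⟩ := exists_aeval_pi_eq hp hx
  set π : NormedAlgClosure F := zeta F p m - 1 with hπdef
  set d := s.natDegree with hd
  have hx_sum : x = ∑ j ∈ Finset.range (d + 1), s.coeff j • π ^ j := by
    rw [← hsx, aeval_eq_sum_range]
  have hne : (Finset.range (d + 1)).Nonempty := ⟨0, Finset.mem_range.mpr (Nat.succ_pos d)⟩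
  obtain ⟨j₀, hj₀, hle⟩ := IsUltrametricDist.exists_norm_finsetSum_le_of_nonempty hne
    (fun j => s.coeff j • π ^ j)
  have hle' : ‖x‖ ≤ ‖s.coeff j₀‖ * ‖π‖ ^ j₀ := by
    rw [← norm_pow, ← norm_smul_base, hx_sum]; exact hle
  have hge := norm_coeff_mul_le_norm_aeval hp hm s hs j₀
  rw [hsx] at hge
  have heq : ‖x‖ = ‖s.coeff j₀‖ * ‖π‖ ^ j₀ := le_antisymm hle' hge
  have hc0 : s.coeff j₀ ≠ 0 := by
    intro h
    rw [h, norm_zero, zero_mul] at heq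
    exact hx0 (norm_eq_zero.mp heq)
  set t : ℝ := ‖(p : PadicBase F p hp)‖ with ht
  have ht0 : 0 < t := PadicBase.norm_p_pos hp
  have hπφ : ‖π‖ ^ (p ^ m).totient = t := by
    rw [ht, hπdef, norm_zeta_sub_one_pow hm, PadicBase.norm_natCast_closure]
  have hπ0 : ‖π‖ ≠ 0 := (norm_zeta_sub_one_pos (F := F) (p := p) hm).ne'
  obtain ⟨v, hv⟩ : ∃ v : ℤ, ‖s.coeff j₀‖ = t ^ v := ⟨_, PadicBase.norm_eq_norm_p_zpow hp _ hc0⟩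
  refine ⟨((p ^ m).totient : ℤ) * v + j₀, ?_⟩
  rw [heq, hv, ← hπφ, zpow_add₀ hπ0, zpow_mul, zpow_natCast, zpow_natCast]

/-- **The value group of `K_∞` is `p`-divisible**: every non-zero `x ∈ K_∞` has some `c ∈ K_∞` with
`‖c‖ ^ p = ‖x‖` (`‖x‖ = ‖π_m‖^N` and `‖μ - 1‖^p = ‖π_m‖` for a primitive `p^{m+1}`-th root `μ ∈ K (m+1)`;
take `c = (μ - 1)^N`). First half of the almost-perfectoid package of `K_∞` used by the Kummer-depth
proof of Tate's almost étale lemma. [cite: Tate1967, §3.2 Prop. 9] [cite: BergerColmez2008, Prop. 4.1.1] -/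
theorem Kinf_exists_norm_pow_eq {x : NormedAlgClosure F} (hx : x ∈ Kinf hp) (hx0 : x ≠ 0) :
    ∃ c : NormedAlgClosure F, c ∈ Kinf hp ∧ ‖c‖ ^ p = ‖x‖ := by
  obtain ⟨M, hM, hxM⟩ := exists_mem_K_of_mem_Kinf hp hx 0
  obtain ⟨N, hN⟩ := exists_norm_eq_zpow_of_mem_K hp hM hxM hx0
  obtain ⟨μ, hμK, hμprim, -⟩ := exists_isPrimitiveRoot_pow_eq_zeta hp hM
  have hμ1 : μ - 1 ∈ K hp (M + 1) := sub_mem hμK (one_mem _)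
  refine ⟨(μ - 1) ^ N, K_le_Kinf hp _ (zpow_mem hμ1 N), ?_⟩
  rw [norm_zpow, ← zpow_natCast, ← zpow_mul, mul_comm, zpow_mul, zpow_natCast,
    norm_sub_one_pow_prime_eq hM hμprim, hN]

end TateAlmostEtale

end Literature.NumberTheory.PAdicHodge

end
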